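import Mathlib.RingTheory.AlgebraicIndependent.TranscendenceBasis
import Mathlib.Algebra.MvPolynomial.Funext
import Mathlib.Algebra.MvPolynomial.Equiv
import Mathlib.LinearAlgebra.Lagrange
import Literature.Computability.AlgebraicComplexity.RazElusiveGeneralProofs
import Literature.Computability.AlgebraicComplexity.RazElusiveGeneralRoute
import Literature.Computability.AlgebraicComplexity.ValiantConjectureProofs
import HarnessLib

/-!
# Non-explicit elusive curves exist; `raz_elusive_curve` is equivalent to `PER ∉ VP_ℂ`

Companion (proofs only, no new named facts) to `RazElusiveGeneral.lean` and
`RazElusiveGeneralProofs.lean`.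

Raz (2010), §1, p. 137 (conference version STOC 2008: second page), after stating results 1–2: "In both of the
above two examples, as well as in all other cases discussed in this paper, it is not hard to show
the existence of (non-explicit) polynomial mappings `f : Fⁿ → F^m`, with the required properties.
The hard problem is to construct `f` explicitly. We note also that polynomial mappings
`f : Fⁿ → F^m`, as above, can easily be constructed from a set `H` of `2ⁿ` points in `F^m` such
that for every mapping `Γ : Fˢ → F^m`, as above, `H` is not contained in the image of `Γ`. Once
again, it is not hard to prove the existence of such a set `H`, and the hard problem is to
construct `H` explicitly." No proof is printed. This file PROVES the existence statement over
every infinite field, for curves (one variable, hence for any number `n ≥ 1` of variables) and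
with an explicit polynomial degree bound:

* `exists_isElusive_curve`: for `s < m` and any `r`, over an infinite field `F` there is a curve
  `f : F → F^m` with coordinates of degree `≤ m · C(s + r, r)` that is `(s, r)`-elusive
  (`IsElusive`, Raz Def. 1.1); `exists_isElusive_map` is the same in `n ≥ 1` variables, and
  `exists_isElusive_curveFamily` packages the case `(s, r) = (m - 1, 2)` of the abstract as a
  family indexed by `m` with p-bounded degree (`≤ m · C(m + 1, 2)`).
* Consequently (`raz_elusive_curve_iff` of `RazElusiveGeneralProofs.lean`: the explicitness
  clause of the tree's `raz_elusive_curve` is void) the misstated fact `raz_elusive_curve` is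
  EQUIVALENT to "the permanent family over `ℂ` is not a `VP` family"
  (`raz_elusive_curve_iff_not_isVPFamily`) and to the tree's open conjecture
  `PerNotPComputableComplex` (**pnp.S04**, `ValiantConjecture.lean`; Bürgisser 2000, Rem. 2.11:
  equivalent to `VP_ℂ ≠ VNP_ℂ`) (`raz_elusive_curve_iff_perNotPComputableComplex`). In
  particular `raz_elusive_curve` cannot be discharged short of separating `VP_ℂ` from `VNP_ℂ`,
  and it is not refutable short of collapsing them; Raz's theorem is `Raz2010_cor_5_8` /
  `Raz2010_elusive_curve` (`RazElusiveGeneral.lean`).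
* Raz's own formulation and regime (p. 137): `exists_points_not_subset_range` is his "set `H`
  of `2ⁿ` points in `F^m` such that for every mapping `Γ : Fˢ → F^m`, as above, `H` is not
  contained in the image of `Γ`" (here: `N` points, as soon as `m · C(s + r, r) + N · s < N · m`),
  `IsElusive.of_points` his "polynomial mappings `f` … can easily be constructed from a set `H`"
  (any map through `H` is elusive; the curve of `exists_isElusive_curve` is the Lagrange
  interpolant), and `exists_isElusive_multilinear` his "an elusive polynomial mapping of degree up
  to `2ⁿ` … is also sufficient, since we can easily construct from it a multilinear polynomial
  mapping" — the multilinearisation (Prop. 1.2, `multilinearize` of `RazElusiveGeneral.lean`) of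
  the elusive curve: `(s, r)`-elusive maps `F^K → F^m` of degree `≤ K` whenever
  `2^K > m · C(s + r, r)`. Finally `exists_nonexplicit_family_result_1`: all hypotheses of
  `Raz2010_result_1` (§1, result 1: `m ≥ n^{ω(1)}`, `s ≥ m^{0.9}`, degree poly(`n`),
  `(s, 2)`-elusive) EXCEPT poly(`n`)-definability are met by a non-explicit family
  (`m = 2^{⌊n/4⌋}`, `s = m - 1`, degree `≤ n`) — the content of Raz's theorem is exactly the
  explicitness (p. 137: "The hard problem is to construct `f` explicitly").

## The proof (Raz's "set `H` of points", p. 137, made quantitative)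

Fix `s < m`, `r`, and put `M = C(s + r, r)` (the number of monomials of degree `≤ r` in `s`
variables, `card_degLeMonomials`) and `N = m · M + 1`. Consider the *universal family*
`Φ_{j,i} = Σ_{|e| ≤ r} a_{i,e} · y_j^e ∈ F[a, y]` (`ElusiveExistence.universalEval`): the `i`-th
coordinate of the generic degree-`≤ r` map `Γ_a : Fˢ → F^m` evaluated at the `j`-th of `N`
generic points `y_j ∈ Fˢ`. It consists of `N · m` polynomials in `m · M + N · s < N · m`
variables, so the `Φ_{j,i}` are algebraically dependent
(`exists_aeval_eq_zero_of_card_lt`, from Mathlib's transcendence degree of a polynomial ring,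
`MvPolynomial.trdeg_of_isDomain`): `P(Φ) = 0` for some nonzero `P ∈ F[w_{j,i}]`. As `F` is
infinite, `P(W) ≠ 0` for some `W ∈ (F^m)^N` (`MvPolynomial.funext`); these `N` points of `F^m`
form Raz's set `H`: if they all lay in `Image(Γ)` for a degree-`≤ r` map `Γ = Γ_a`, say
`W_j = Γ(y_j)`, then `W = Φ(a, y)` and `P(W) = P(Φ)(a, y) = 0`
(`ElusiveExistence.eval_universalPoint_universalEval`). Finally Lagrange interpolation
(`Lagrange.interpolate`) through `W` at `N` distinct nodes gives a curve of degree `≤ N - 1 = m · M`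
passing through all the `W_j`, hence eluding every such `Γ`.

## References

* R. Raz, *Elusive functions and lower bounds for arithmetic circuits*, Theory of Computing 6
  (2010) 135–177: abstract (p. 135); §1, results 1–2 (p. 136) and the existence remark (p. 137);
  Def. 1.1. Conference version: STOC 2008, pp. 711–720 (the same remark on its p. 2).
* P. Bürgisser, *Completeness and Reduction in Algebraic Complexity Theory* (2000), Rem. 2.11
  (`PER ∉ VP_ℂ ⟺ VP_ℂ ≠ VNP_ℂ`), for the reading of `PerNotPComputableComplex`.

## Design notes / not here

* Only infinite fields (this covers `F = ℂ` of the abstract and of `raz_elusive_curve`); over a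
  finite field the existence of elusive maps in Raz's regime is a counting argument with other
  degree bounds, not vendored.
* The degree bound `m · C(s + r, r)` is what interpolation through `m · C(s + r, r) + 1` points
  gives; no attempt at optimality. Nothing here is explicit in Raz's sense (Def. 1.3): the curve
  depends on a non-root `W` of an unspecified annihilating polynomial.
-/

noncomputable section

open MvPolynomial

namespace Literature.Computability.AlgebraicComplexity

universe u v w

/-! ### More polynomials than variables are algebraically dependent -/

/-- **Algebraic dependence by counting variables.** Over an integral domain `F`, any family of
`#τ > #σ` polynomials `Φ : τ → F[σ]` (finitely many variables) satisfies a non-trivial polynomial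
relation: `P(Φ) = 0` for some `P ≠ 0` in `F[τ]`. (The transcendence degree of `F[σ]` over `F` is
`#σ`, Mathlib's `MvPolynomial.trdeg_of_isDomain`, and an algebraically independent family has
cardinality at most the transcendence degree, `AlgebraicIndependent.lift_cardinalMk_le_trdeg`.)
[folklore] -/
theorem exists_aeval_eq_zero_of_card_lt {F : Type u} [CommRing F] [IsDomain F] {σ : Type v}
    {τ : Type w} [Fintype σ] [Fintype τ] (h : Fintype.card σ < Fintype.card τ)
    (Φ : τ → MvPolynomial σ F) : ∃ P : MvPolynomial τ F, P ≠ 0 ∧ aeval Φ P = 0 := by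
  by_contra hne
  push Not at hne
  have hind : AlgebraicIndependent F Φ :=
    algebraicIndependent_iff.2 fun p hp => by_contra fun hp0 => hne p hp0 hp
  have := hind.lift_cardinalMk_le_trdeg
  rw [MvPolynomial.trdeg_of_isDomain] at this
  simp only [Cardinal.mk_fintype, Cardinal.lift_natCast, Nat.cast_le] at this
  omega

/-! ### Monomials of degree at most `r` -/

/-- The exponent vectors of total degree `≤ r` in `s` variables (the monomials that may occur in a
coordinate of a degree-`≤ r` polynomial mapping `Fˢ → F^m`), as the union over `j ≤ r` of the
tree's `degreeMonomials s j` (Raz's sets `M` of degree exactly `j`, `RazElusiveGeneralRoute.lean`).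
[folklore] -/
def degLeMonomials (s r : ℕ) : Finset (Fin s →₀ ℕ) :=
  (Finset.range (r + 1)).biUnion fun j => degreeMonomials s j

/-- Membership in `degLeMonomials`: the exponents sum to at most `r`. [folklore] -/
theorem mem_degLeMonomials {s r : ℕ} {e : Fin s →₀ ℕ} :
    e ∈ degLeMonomials s r ↔ ∑ i, e i ≤ r := by
  simp [degLeMonomials, mem_degreeMonomials]

/-- `|{e : |e| ≤ r}| = C(s + r, r)` (stars and bars: `Σ_{j ≤ r} C(s + j - 1, j) = C(s + r, r)`).
[folklore] -/
theorem card_degLeMonomials (s r : ℕ) : (degLeMonomials s r).card = Nat.choose (s + r) r := by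
  unfold degLeMonomials
  rw [Finset.card_biUnion]
  · simp_rw [card_degreeMonomials]
    induction r with
    | zero => simp
    | succ r ih =>
      rw [Finset.sum_range_succ, ih, show s + (r + 1) - 1 = s + r by omega,
        show s + (r + 1) = s + r + 1 by omega, Nat.choose_succ_succ']
  · intro i _ j _ hij
    exact Finset.disjoint_left.2 fun e hi hj =>
      hij ((mem_degreeMonomials.1 hi).symm.trans (mem_degreeMonomials.1 hj))

/-- The support of a polynomial of total degree `≤ r` consists of exponents of degree `≤ r`.
[folklore] -/
theorem support_subset_degLeMonomials {F : Type u} [CommSemiring F] {s r : ℕ}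
    {p : MvPolynomial (Fin s) F} (hp : p.totalDegree ≤ r) : p.support ⊆ degLeMonomials s r := by
  intro e he
  have h := le_totalDegree he
  rw [e.sum_fintype _ (fun _ => rfl)] at h
  exact mem_degLeMonomials.2 (h.trans hp)

/-! ### The universal family: the generic degree-`≤ r` map at `N` generic points -/

namespace ElusiveExistence

variable (F : Type u) [CommSemiring F]

/-- Variables of the universal family: a coefficient variable `a_{i,e}` for each output
coordinate `i < m` and each exponent `e` of degree `≤ r` in `s` variables, and a coordinate
variable `y_{j,l}` for each of `N` points `y_j ∈ Fˢ`. [folklore] -/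
abbrev UVar (m s r N : ℕ) : Type :=
  (Fin m × ↥(degLeMonomials s r)) ⊕ (Fin N × Fin s)

/-- The universal family `Φ_{j,i} = Σ_{|e| ≤ r} a_{i,e} · Π_l y_{j,l}^{e_l}`: the `i`-th
coordinate of the generic degree-`≤ r` polynomial mapping `Γ_a = (Σ_e a_{i,e} yᵉ)_i : Fˢ → F^m`
evaluated at the `j`-th generic point `y_j`. [folklore] -/
def universalEval (m s r N : ℕ) (ji : Fin N × Fin m) : MvPolynomial (UVar m s r N) F :=
  ∑ e : ↥(degLeMonomials s r),
    X (Sum.inl (ji.2, e)) *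
      rename (fun l : Fin s => (Sum.inr (ji.1, l) : UVar m s r N)) (monomial e.1 1)

variable {F}

/-- The values of the universal variables determined by a concrete polynomial mapping `Γ`
(its coefficients) and concrete points `y_0, …, y_{N-1} ∈ Fˢ`. [folklore] -/
def universalPoint {m s r N : ℕ} (Γ : Fin m → MvPolynomial (Fin s) F)
    (y : Fin N → Fin s → F) : UVar m s r N → F :=
  Sum.elim (fun ie => coeff ie.2.1 (Γ ie.1)) (fun jl => y jl.1 jl.2)

/-- `universalPoint` on a coefficient variable `a_{i,e}`: the coefficient of `yᵉ` in `Γ_i`.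
[folklore] -/
@[simp] theorem universalPoint_inl {m s r N : ℕ} (Γ : Fin m → MvPolynomial (Fin s) F)
    (y : Fin N → Fin s → F) (ie : Fin m × ↥(degLeMonomials s r)) :
    universalPoint Γ y (Sum.inl ie) = coeff ie.2.1 (Γ ie.1) := rfl

/-- `universalPoint` on a point variable `y_{j,l}`: the `l`-th coordinate of `y_j`. [folklore] -/
@[simp] theorem universalPoint_inr {m s r N : ℕ} (Γ : Fin m → MvPolynomial (Fin s) F)
    (y : Fin N → Fin s → F) (jl : Fin N × Fin s) :
    universalPoint (r := r) Γ y (Sum.inr jl) = y jl.1 jl.2 := rfl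

/-- **Universality.** At the values determined by a degree-`≤ r` mapping `Γ` and points `y_j`,
the universal family evaluates to `Γ_i(y_j)`: every coordinate `Γ_i` is `Σ_{|e| ≤ r} coeff_e(Γ_i) yᵉ`.
[folklore] -/
theorem eval_universalPoint_universalEval {m s r N : ℕ} {Γ : Fin m → MvPolynomial (Fin s) F}
    (hΓ : ∀ i, (Γ i).totalDegree ≤ r) (y : Fin N → Fin s → F) (ji : Fin N × Fin m) :
    eval (universalPoint Γ y) (universalEval F m s r N ji) = eval (y ji.1) (Γ ji.2) := by
  unfold universalEval
  rw [map_sum]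
  simp_rw [map_mul, eval_X, eval_rename, universalPoint_inl]
  have hcomp : (universalPoint Γ y ∘ fun l : Fin s => (Sum.inr (ji.1, l) : UVar m s r N)) =
      y ji.1 := funext fun l => rfl
  simp_rw [hcomp]
  rw [Finset.sum_coe_sort (degLeMonomials s r)
    (fun e => coeff e (Γ ji.2) * eval (y ji.1) (monomial e 1))]
  conv_rhs => rw [(Γ ji.2).as_sum, map_sum, Finset.sum_subset
    (support_subset_degLeMonomials (hΓ ji.2)) (fun e _ he => by
      rw [notMem_support_iff.1 he, map_zero, map_zero])]
  refine Finset.sum_congr rfl fun e _ => ?_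
  rw [eval_monomial, eval_monomial, one_mul]

end ElusiveExistence

/-! ### Univariate polynomials as curves -/

/-- The total degree of `p(x_i) ∈ F[x_σ]` (Mathlib's `Polynomial.toMvPolynomial i p`) is at most
`deg p`. [folklore] -/
theorem totalDegree_toMvPolynomial_le {F : Type u} [Field F] {σ : Type v} (p : Polynomial F)
    (i : σ) : (p.toMvPolynomial i).totalDegree ≤ p.natDegree := by
  rw [Polynomial.toMvPolynomial, Polynomial.aeval_eq_sum_range]
  refine (totalDegree_finsetSum _ _).trans (Finset.sup_le fun k hk => ?_)
  refine (totalDegree_smul_le _ _).trans ((totalDegree_pow _ _).trans ?_)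
  rw [totalDegree_X]
  simpa using Nat.lt_succ_iff.1 (Finset.mem_range.1 hk)

/-! ### Raz's set `H` of points (Raz 2010, p. 137) -/

open ElusiveExistence in
/-- **A finite point set covered by no degree-`≤ r` map** (Raz 2010, §1, p. 137: "a set `H` of
`2ⁿ` points in `F^m` such that for every mapping `Γ : Fˢ → F^m`, as above, `H` is not contained
in the image of `Γ`. Once again, it is not hard to prove the existence of such a set `H`"; no
proof printed). Quantitative form over an infinite field: `N` points `W_0, …, W_{N-1} ∈ F^m`
suffice as soon as `m · C(s + r, r) + N · s < N · m` — the universal family then has fewer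
variables than coordinates, so it has a nonzero annihilator `P` (`exists_aeval_eq_zero_of_card_lt`),
and any non-root `W` of `P` (`MvPolynomial.funext`, `F` infinite) works: `W_j = Γ(y_j)` for all
`j` would give `P(W) = P(Φ)(coeffs Γ, y) = 0` (`eval_universalPoint_universalEval`).
[cite: Raz2010, §1 (p. 137)] -/
theorem exists_points_not_subset_range (F : Type u) [Field F] [Infinite F] {m s r N : ℕ}
    (hN : m * Nat.choose (s + r) r + N * s < N * m) :
    ∃ W : Fin N → Fin m → F, ∀ Γ : Fin m → MvPolynomial (Fin s) F,
      (∀ i, (Γ i).totalDegree ≤ r) → ¬ (Set.range W ⊆ Set.range (polyMapEval Γ)) := by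
  classical
  -- (1) the universal family is algebraically dependent: `P(Φ) = 0`, `P ≠ 0`
  have hcard : Fintype.card (UVar m s r N) < Fintype.card (Fin N × Fin m) := by
    simpa only [UVar, Fintype.card_sum, Fintype.card_prod, Fintype.card_fin, Fintype.card_coe,
      card_degLeMonomials] using hN
  obtain ⟨P, hP0, hP⟩ := exists_aeval_eq_zero_of_card_lt hcard (universalEval F m s r N)
  -- (2) a non-root `W ∈ (F^m)^N` of `P`
  obtain ⟨W, hW⟩ : ∃ W : Fin N × Fin m → F, eval W P ≠ 0 := by
    by_contra h
    push Not at h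
    exact hP0 (MvPolynomial.funext fun x => by rw [h x, map_zero])
  -- (3) `H = {W_j} ⊆ Image Γ` would force `P(W) = 0`
  refine ⟨fun j i => W (j, i), fun Γ hΓ hsub => hW ?_⟩
  have hy : ∀ j, ∃ y : Fin s → F, ∀ i, eval y (Γ i) = W (j, i) := fun j => by
    obtain ⟨y, hy⟩ := hsub (Set.mem_range_self j)
    exact ⟨y, fun i => by simpa only [polyMapEval_apply] using congr_fun hy i⟩
  choose y hy using hy
  have h0 := congr_arg (eval (universalPoint Γ y)) hP
  rw [map_zero, aeval_eq_bind₁] at h0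
  have h1 : eval (universalPoint Γ y) (bind₁ (universalEval F m s r N) P) =
      eval (fun ji => eval (universalPoint Γ y) (universalEval F m s r N ji)) P :=
    eval₂Hom_bind₁ _ _ _ _
  rw [h1] at h0
  have hWeq : W = fun ji => eval (universalPoint Γ y) (universalEval F m s r N ji) := by
    funext ji
    rw [eval_universalPoint_universalEval hΓ y ji, hy]
  rw [hWeq]
  exact h0

/-- **Elusiveness from a point set** (Raz 2010, p. 137: elusive "polynomial mappings … can
easily be constructed from a set `H`" as above): a polynomial mapping whose image contains a
point set covered by no degree-`≤ r` map `Fˢ → F^m` is `(s, r)`-elusive.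
[cite: Raz2010, §1 (p. 137)] -/
theorem IsElusive.of_points {F : Type u} [CommSemiring F] {σ' : Type v} {m s r N : ℕ}
    {W : Fin N → Fin m → F}
    (hW : ∀ Γ : Fin m → MvPolynomial (Fin s) F,
      (∀ i, (Γ i).totalDegree ≤ r) → ¬ (Set.range W ⊆ Set.range (polyMapEval Γ)))
    {f : Fin m → MvPolynomial σ' F} (hf : ∀ j, W j ∈ Set.range (polyMapEval f)) :
    IsElusive f s r :=
  fun Γ hΓ hsub => hW Γ hΓ (by
    rintro _ ⟨j, rfl⟩
    exact hsub (hf j))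

/-! ### Existence of elusive curves and maps (Raz 2010, p. 137) -/

/-- **Non-explicit elusive curves exist** (Raz 2010, §1, p. 137: "it is not hard to show the
existence of (non-explicit) polynomial mappings `f : Fⁿ → F^m`, with the required properties.
The hard problem is to construct `f` explicitly"; stated there without proof for the settings of
the paper — proved here for curves over infinite fields with an explicit degree bound, by Raz's
own device of a finite point set `H ⊄ Image(Γ)` for all `Γ` plus interpolation, see the module
docstring). For `s < m`, any `r`, and any infinite field `F`, there is a curve
`f = (f_i)_{i<m} : F → F^m` with all coordinates of degree `≤ m · C(s + r, r)` which is
`(s, r)`-elusive (Def. 1.1, `IsElusive`): its image is contained in the image of no polynomial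
mapping `Γ : Fˢ → F^m` of degree `≤ r`. [cite: Raz2010, §1 (p. 137)] -/
theorem exists_isElusive_curve (F : Type u) [Field F] [Infinite F] {m s : ℕ} (hsm : s < m)
    (r : ℕ) :
    ∃ f : Fin m → MvPolynomial (Fin 1) F,
      (∀ i, (f i).totalDegree ≤ m * Nat.choose (s + r) r) ∧ IsElusive f s r := by
  -- Raz's point set `H` with `N = m · C(s + r, r) + 1` points
  set N : ℕ := m * Nat.choose (s + r) r + 1 with hN
  have hlt : m * Nat.choose (s + r) r + N * s < N * m := by
    have h1 : N * (s + 1) ≤ N * m := Nat.mul_le_mul_left N hsm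
    have h2 : m * Nat.choose (s + r) r < N := Nat.lt_succ_self _
    nlinarith
  obtain ⟨W, hW⟩ := exists_points_not_subset_range F hlt
  -- `N` distinct nodes and Lagrange interpolation through `H`
  set t : Fin N → F := fun j => Infinite.natEmbedding F j with ht_def
  have ht : Function.Injective t :=
    (Infinite.natEmbedding F).injective.comp Fin.val_injective
  have htinj : Set.InjOn t (Finset.univ : Finset (Fin N)) := ht.injOn
  set p : Fin m → Polynomial F :=
    fun i => Lagrange.interpolate Finset.univ t fun j => W j i with hp_def
  refine ⟨fun i => (p i).toMvPolynomial 0, fun i => ?_, IsElusive.of_points hW fun j =>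
    ⟨fun _ => t j, funext fun i => ?_⟩⟩
  · refine (totalDegree_toMvPolynomial_le _ _).trans ?_
    have hdeg := Lagrange.degree_interpolate_le (fun j => W j i) htinj
    rw [Finset.card_univ, Fintype.card_fin] at hdeg
    have hN1 : N - 1 = m * Nat.choose (s + r) r := by rw [hN, Nat.add_sub_cancel]
    exact (Polynomial.natDegree_le_iff_degree_le.2 hdeg).trans hN1.le
  · rw [polyMapEval_apply, MvPolynomial.eval_toMvPolynomial]
    exact Lagrange.eval_interpolate_at_node _ htinj (Finset.mem_univ j)

/-- **Non-explicit elusive polynomial mappings `Fⁿ → F^m` exist** (Raz 2010, §1, p. 137), in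
Raz's setting of `n ≥ 1` variables: for `s < m`, any `r`, any infinite field `F`, some
`f : Fⁿ → F^m` of degree `≤ m · C(s + r, r)` is `(s, r)`-elusive (the curve of
`exists_isElusive_curve` in the variable `x_0`; elusiveness only depends on the image).
[cite: Raz2010, §1 (p. 137)] -/
theorem exists_isElusive_map (F : Type u) [Field F] [Infinite F] {n m s : ℕ} (hn : 1 ≤ n)
    (hsm : s < m) (r : ℕ) :
    ∃ f : Fin m → MvPolynomial (Fin n) F,
      (∀ i, (f i).totalDegree ≤ m * Nat.choose (s + r) r) ∧ IsElusive f s r := by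
  obtain ⟨f, hdeg, hel⟩ := exists_isElusive_curve F hsm r
  refine ⟨fun i => rename (fun _ : Fin 1 => (⟨0, hn⟩ : Fin n)) (f i),
    fun i => (totalDegree_rename_le _ _).trans (hdeg i), hel.of_range_eq ?_⟩
  ext w
  constructor
  · rintro ⟨y, rfl⟩
    exact ⟨y ∘ fun _ : Fin 1 => (⟨0, hn⟩ : Fin n), (polyMapEval_rename _ f y).symm⟩
  · rintro ⟨x, rfl⟩
    refine ⟨fun _ => x 0, ?_⟩
    rw [polyMapEval_rename]
    congr 1
    funext j
    simp [Fin.eq_zero j]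

/-- **The curves of the abstract exist non-explicitly, with polynomial degree:** over any
infinite field there is a family of curves `f m : F → F^m` (`m ∈ ℕ`) whose degrees are p-bounded
in `m` (`≤ m · C(m + 1, 2) ≤ 4 (m + 1)³`) and such that `f m` is `(m - 1, 2)`-elusive for every
`m ≥ 1` — the image of `f m` is not contained in the image of any polynomial mapping
`F^{m-1} → F^m` of degree `2` (Raz 2010, abstract and p. 137; at `m = 0` nothing is elusive and
the family is the empty tuple). [cite: Raz2010, §1 (p. 137)] -/
theorem exists_isElusive_curveFamily (F : Type u) [Field F] [Infinite F] :
    ∃ f : ∀ m : ℕ, Fin m → MvPolynomial (Fin 1) F,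
      IsPBounded (fun m => Finset.univ.sup fun i : Fin m => (f m i).totalDegree) ∧
        ∀ m ≥ 1, IsElusive (f m) (m - 1) 2 := by
  have h : ∀ m : ℕ, ∃ f : Fin m → MvPolynomial (Fin 1) F,
      (∀ i, (f i).totalDegree ≤ m * Nat.choose (m - 1 + 2) 2) ∧
        (1 ≤ m → IsElusive f (m - 1) 2) := by
    intro m
    rcases Nat.eq_zero_or_pos m with rfl | hm
    · exact ⟨fun i => i.elim0, fun i => i.elim0, fun h => absurd h (by decide)⟩
    · obtain ⟨f, hdeg, hel⟩ := exists_isElusive_curve F (show m - 1 < m by omega) 2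
      exact ⟨f, hdeg, fun _ => hel⟩
  choose f hdeg hel using h
  refine ⟨f, (IsPBounded.iff_exists_le_mul_succ_pow _).2 ⟨4, 3, fun m => ?_⟩, hel⟩
  refine Finset.sup_le fun i _ => (hdeg m i).trans ?_
  have hc : Nat.choose (m - 1 + 2) 2 ≤ (2 * (m + 1)) ^ 2 :=
    (Nat.choose_le_pow _ _).trans (Nat.pow_le_pow_left (show m - 1 + 2 ≤ 2 * (m + 1) by omega) 2)
  calc m * Nat.choose (m - 1 + 2) 2 ≤ (m + 1) * (2 * (m + 1)) ^ 2 :=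
        Nat.mul_le_mul (Nat.le_succ m) hc
    _ = 4 * (m + 1) ^ 3 := by ring

/-! ### `raz_elusive_curve` ⟺ `PER ∉ VP_ℂ` -/

/-- **The misstated fact `raz_elusive_curve` is equivalent to "`PER` is not a `VP` family over
`ℂ`".** By `raz_elusive_curve_iff` its explicitness clause is void, so it reads "if some
polynomial-degree curve family is eventually `(m-1, 2)`-elusive then `PER ∉ VP_ℂ`", and such a
family exists (`exists_isElusive_curveFamily ℂ`). [folklore] -/
theorem raz_elusive_curve_iff_not_isVPFamily :
    raz_elusive_curve ↔ ¬ IsVPFamily (fun n => perPoly (Fin n) ℂ) := by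
  rw [raz_elusive_curve_iff]
  obtain ⟨f, hdeg, hel⟩ := exists_isElusive_curveFamily ℂ
  exact ⟨fun h => h ⟨f, hdeg, 1, hel⟩, fun h _ => h⟩

/-- **`raz_elusive_curve` is equivalent to the open conjecture `PerNotPComputableComplex`**
(**pnp.S04**, "the permanent family is not p-computable over `ℂ`", which by Bürgisser 2000,
Rem. 2.11 is equivalent to `VP_ℂ ≠ VNP_ℂ`): the permanent family is a p-family
(`isPFamily_perPoly_holds`), so `PER ∉ VP_ℂ ⟺ PER` not p-computable. Hence the named fact
`raz_elusive_curve` can be neither discharged nor refuted short of settling Valiant's hypothesis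
over `ℂ`; Raz's printed theorem is `Raz2010_cor_5_8` (and the corrected curve statement
`Raz2010_elusive_curve`). [folklore] -/
theorem raz_elusive_curve_iff_perNotPComputableComplex :
    raz_elusive_curve ↔ PerNotPComputableComplex := by
  rw [raz_elusive_curve_iff_not_isVPFamily, PerNotPComputableComplex, IsVPFamily, not_and]
  exact ⟨fun h => h isPFamily_perPoly_holds, fun h _ => h⟩

/-! ### Multilinear elusive maps of degree `≤ K`, and the non-explicit content of result 1 -/

/-- **Non-explicit elusive maps of degree `≤ K` in `K` variables** (Raz 2010, §1, p. 137: "an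
elusive polynomial mapping `f : Fⁿ → F^m` of degree up to `2ⁿ`, (rather than poly(`n`)), is
also sufficient, since we can easily construct from it a multilinear polynomial mapping `f̂` …
such that the image of `f` is contained in the image of `f̂`" — Prop. 1.2, the tree's
`multilinearize` / `IsElusive.multilinearize`, applied to the non-explicit elusive curve of
`exists_isElusive_curve`, whose degree `m · C(s + r, r)` is `< 2^K`): over an infinite field,
for `s < m`, any `r` and `2^K > m · C(s + r, r)` there is `f : F^K → F^m` with coordinates of
total degree `≤ K` that is `(s, r)`-elusive. This is the regime of results 1–2 (p. 136): degree
poly in the number of variables while `m` is super-polynomial in it.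
[cite: Raz2010, §1 (p. 137), Prop. 1.2] -/
theorem exists_isElusive_multilinear (F : Type u) [Field F] [Infinite F] {m s K : ℕ}
    (hsm : s < m) (r : ℕ) (hK : m * Nat.choose (s + r) r < 2 ^ K) :
    ∃ f : Fin m → MvPolynomial (Fin K) F, (∀ i, (f i).totalDegree ≤ K) ∧ IsElusive f s r := by
  obtain ⟨g, hdeg, hel⟩ := exists_isElusive_curve F hsm r
  exact ⟨fun i => multilinearize K (g i), fun i => totalDegree_multilinearize_le K (g i),
    hel.multilinearize fun i => lt_of_le_of_lt (hdeg i) hK⟩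

/-- `n^c ≤ 2^{⌊n/4⌋}` for all large `n`. [folklore] -/
theorem eventually_pow_le_two_pow_div_four (c : ℕ) : ∃ n₀ : ℕ, ∀ n ≥ n₀, n ^ c ≤ 2 ^ (n / 4) := by
  obtain ⟨T, hT⟩ := eventually_mul_pow_lt_two_pow c (7 ^ c)
  refine ⟨4 * (T + 1), fun n hn => ?_⟩
  have ht : T ≤ n / 4 := by omega
  have hn7 : n ≤ 7 * (n / 4) := by omega
  calc n ^ c ≤ (7 * (n / 4)) ^ c := Nat.pow_le_pow_left hn7 c
    _ = 7 ^ c * (n / 4) ^ c := by rw [mul_pow]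
    _ ≤ 2 ^ (n / 4) := (hT _ ht).le

/-- **The non-explicit content of `Raz2010_result_1` is consistent**: over any infinite field
there are `m(n) = 2^{⌊n/4⌋} ≥ n^{ω(1)}`, `s = m - 1 ≥ m^{0.9}` (eventually) and maps
`f n : Fⁿ → F^{m(n)}` of degree `≤ n` that are `(s(n), 2)`-elusive for all `n ≥ 12` — i.e. all
hypotheses of `Raz2010_result_1` (§1, result 1, p. 136) except poly(`n`)-definability
(Def. 1.3) are met by a non-explicit family (Raz, p. 137: "The hard problem is to construct `f`
explicitly"). [cite: Raz2010, §1 (pp. 136–137)] -/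
theorem exists_nonexplicit_family_result_1 (F : Type u) [Field F] [Infinite F] :
    ∃ (m s : ℕ → ℕ) (f : ∀ n : ℕ, Fin (m n) → MvPolynomial (Fin n) F),
      (∀ c : ℕ, ∃ n₀ : ℕ, ∀ n ≥ n₀, n ^ c ≤ m n) ∧
        (∃ n₀ : ℕ, ∀ n ≥ n₀, m n ^ 9 ≤ s n ^ 10) ∧
          IsPBounded (fun n => Finset.univ.sup fun i : Fin (m n) => (f n i).totalDegree) ∧
            ∃ n₀ : ℕ, ∀ n ≥ n₀, IsElusive (f n) (s n) 2 := by
  have h : ∀ n : ℕ, ∃ f : Fin (2 ^ (n / 4)) → MvPolynomial (Fin n) F,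
      (∀ i, (f i).totalDegree ≤ n) ∧ (12 ≤ n → IsElusive f (2 ^ (n / 4) - 1) 2) := by
    intro n
    by_cases hn : 12 ≤ n
    · have h1 : 1 ≤ 2 ^ (n / 4) := Nat.one_le_two_pow
      obtain ⟨f, hdeg, hel⟩ := exists_isElusive_multilinear F (K := n)
        (show 2 ^ (n / 4) - 1 < 2 ^ (n / 4) by omega) 2 (by
          -- `m · C(m + 1, 2) ≤ m (m + 1)² ≤ 4 m³ = 2^{3⌊n/4⌋ + 2} < 2ⁿ` for `n ≥ 12`
          set m := 2 ^ (n / 4) with hm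
          calc m * Nat.choose (m - 1 + 2) 2 ≤ m * (m - 1 + 2) ^ 2 :=
                Nat.mul_le_mul_left _ (Nat.choose_le_pow _ _)
            _ ≤ m * (2 * m) ^ 2 :=
                Nat.mul_le_mul_left _ (Nat.pow_le_pow_left (show m - 1 + 2 ≤ 2 * m by omega) 2)
            _ = 2 ^ (3 * (n / 4) + 2) := by rw [hm]; ring
            _ < 2 ^ n := Nat.pow_lt_pow_right (by norm_num) (by omega))
      exact ⟨f, hdeg, fun _ => hel⟩
    · exact ⟨fun _ => 0, fun i => by simp, fun h => absurd h hn⟩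
  choose f hdeg hel using h
  refine ⟨fun n => 2 ^ (n / 4), fun n => 2 ^ (n / 4) - 1, f, eventually_pow_le_two_pow_div_four,
    ⟨40, fun n hn => pow_nine_le_pred_pow_ten ?_⟩,
    IsPBounded.id.mono fun n => Finset.sup_le fun i _ => hdeg n i, 12, fun n hn => hel n hn⟩
  calc 1024 = 2 ^ 10 := by norm_num
    _ ≤ 2 ^ (n / 4) := Nat.pow_le_pow_right (by norm_num) (by omega)

end Literature.Computability.AlgebraicComplexity
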